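import Summits.QuantumFields.YangMills.Theorems.UnitScaleTiltProp7IterLambdaBound
import Summits.QuantumFields.YangMills.Theorems.UnitScaleTiltProp7CombGauge
import HarnessLib

/-!
# Route `UnitScaleTilt`, crux K1 «MinimiserStabilityRegPr» (stmt-QuantumFields-19200), line «route-R» (`Lines/birth_routeR.lean` v2 5b75208179c6919a),
# stub P `stub_relPoincareOpt` — linear flat core, step N7-A of the P-lin-flat plan (CARD-19200-V3-g11): THE TRUE CONSTRAINT READ ON THE HODGE PARTS —
# `L^k·(Q_kB)(c) + (φ(y′₀) − φ(y₀)) = Λ_B(y′) − Λ_B(y)`, WITH `Λ_B` `(H¹)^*`-BOUNDED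

Cell `ym3-torus` ∕ fleet seat `ym-ust-19200-p1` (gen 11, route-R lead).  WHY.  The assembly N7 reads the constraint `Q^{(k)}Y = 0` on a Hodge-split field
`Y = B + ∂φ` (`Prop7PinnedHodgeSplit`, p596259, applied to the real components).  At the MATRIX level (where the abstract composite `Q^{(k)}` of `linAvg`
lives) the structure theorem with the recursion-characterised gauge function (`Prop7IterLinStructureRec`, p596924) is linear in the field, the gauge function of a
pure gauge is `Q′_kφ − φ∘embIter k` (`iterLambda_grad`), and [Balaban1984PropagatorsI] (1.20) gives `L^kQ_k(∂φ) = ∂(Q′_kφ)`; hence the `Q′_kφ` terms cancel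
and the constraint becomes, per coarse bond `c = (y → y′)`, `L^k·(Q_kB)(c) + (φ(embIter k y′) − φ(embIter k y)) = Λ_B(y′) − Λ_B(y)` with `Λ_B` a recursion family
for `B` ALONE — whose `(H¹)^*`-bound is `Prop7IterLambdaBound.norm_sq_iterLambda_le` (N6, d = 3).  This file is that algebra, by name.

WHAT IS PROVED (sorry-free, no definition):
* `iterLambda_add` — recursion families add (linearity of `combMean`, `bondAvgIter`);
* **`constraint_on_hodge_parts`** — for `Y = B + ∂φ` (pointwise), `Q^{(k)}Y = 0` (`k ≤ m + K`) and every recursion family `Λ_B` for `B`: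
  `(L^k : ℕ)•(Q_kB)(c) + (φ(embIter k c.tgt) − φ(embIter k c.src)) = Λ_B(c.tgt) − Λ_B(c.src)` for every level-`k` bond `c`;
* **`exists_constraint_on_hodge_parts_bound`** (d = 3, `M_N(ℂ)` values) — the same with SOME recursion family `Λ_B` satisfying
  `‖Λ_B(y)‖² ≤ ((d+2)L)²·N·L²·L^k/(√L−1)²·E_k(B)(y)` at every k-block (N6).

References: T. Bałaban, CMP 95 (1984) 17–40 [Balaban1984PropagatorsI] ((1.18)–(1.20) pp.19–20); CMP 102 (1985) 277–309 [Balaban1985Variational] (Prop. 7 p.299).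
-/

noncomputable section

open scoped BigOperators Matrix.Norms.L2Operator Matrix

namespace Summit.QuantumFields.YangMills.Theorems.Prop7PinnedConstraintSplit

open Literature.MathematicalPhysics.QuantumFieldTheory.Balaban1983to89
open Finset T4Continuum BlockAveraging BlockAveragingEMLLinearised LatticeFieldCalculus
open B15DeterminingSets (embIter)
open B5Eq120IterProof (bondAvgIter_grad)
open Literature.MathematicalPhysics.QuantumFieldTheory.BalabanImbrieJaffe1984to88.BIJ85AxialPropagator411 (bondAvgIter_add)
open Summit.QuantumFields.YangMills.Theorems.Prop7CombGauge (combMean_add)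
open Summit.QuantumFields.YangMills.Theorems.Prop7IterLinStructureRec (iterLin_eq_of_iterLambda exists_iterLambda iterLambda_grad)
open Summit.QuantumFields.YangMills.Theorems.Prop7IterLambdaBound (norm_sq_iterLambda_le)

variable {P : Params} {n : Type*} [Fintype n] [DecidableEq n] [Nonempty n]

omit [Fintype n] [DecidableEq n] [Nonempty n] in
/-- **RECURSION FAMILIES ADD**: if `Λ₁`, `Λ₂` are recursion families for `Y₁`, `Y₂`, then `Λ₁ + Λ₂` is one for `Y₁ + Y₂`. [folklore] -/
theorem iterLambda_add (Y₁ Y₂ : PBond P 0 → Matrix n n ℂ) (Λ₁ Λ₂ : (k : ℕ) → Site P k → Matrix n n ℂ)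
    (h₁0 : ∀ y, Λ₁ 0 y = 0) (h₁s : ∀ (k : ℕ) (y : Site P (k + 1)), Λ₁ (k + 1) y = (P.L ^ k : ℕ) • combMean (bondAvgIter k Y₁) y + Λ₁ k (emb y))
    (h₂0 : ∀ y, Λ₂ 0 y = 0) (h₂s : ∀ (k : ℕ) (y : Site P (k + 1)), Λ₂ (k + 1) y = (P.L ^ k : ℕ) • combMean (bondAvgIter k Y₂) y + Λ₂ k (emb y)) :
    (∀ y, (fun k y => Λ₁ k y + Λ₂ k y) 0 y = 0) ∧
      ∀ (k : ℕ) (y : Site P (k + 1)), (fun k y => Λ₁ k y + Λ₂ k y) (k + 1) y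
        = (P.L ^ k : ℕ) • combMean (bondAvgIter k (fun b => Y₁ b + Y₂ b)) y + (fun k y => Λ₁ k y + Λ₂ k y) k (emb y) := by
  refine ⟨fun y => by simp [h₁0, h₂0], fun k y => ?_⟩
  simp only [h₁s, h₂s]
  have hQ : bondAvgIter k (fun b => Y₁ b + Y₂ b) = fun b => bondAvgIter k Y₁ b + bondAvgIter k Y₂ b := by
    have := bondAvgIter_add (P := P) k Y₁ Y₂
    exact this
  rw [hQ, combMean_add, smul_add]
  abel

omit [Fintype n] [DecidableEq n] [Nonempty n] in
/-- **THE TRUE CONSTRAINT ON THE HODGE PARTS**: let `Y = B + ∂φ` bond-wise and `Q^{(k)}Y = 0` for the composite `Q^{(k)}` of `linAvg` (`k ≤ m + K`); then for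
every recursion family `Λ_B` for `B` and every level-`k` bond `c`,
`L^k·(Q_kB)(c) + (φ(embIter k c₊) − φ(embIter k c₋)) = Λ_B(c₊) − Λ_B(c₋)`. [cite: Balaban1984PropagatorsI, (1.18)-(1.20) pp.19-20] -/
theorem constraint_on_hodge_parts
    (Q : (i : ℕ) → (PBond P 0 → Matrix n n ℂ) → PBond P i → Matrix n n ℂ)
    (hQ0 : ∀ Y, Q 0 Y = Y) (hQs : ∀ (i : ℕ) (Y : PBond P 0 → Matrix n n ℂ) (c : PBond P (i + 1)), Q (i + 1) Y c = linAvg (Q i Y) c)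
    (Y B : PBond P 0 → Matrix n n ℂ) (φ : Site P 0 → Matrix n n ℂ) (hY : ∀ b, Y b = B b + (φ b.tgt - φ b.src))
    {k : ℕ} (hk : k ≤ P.m + P.K) (hQY : ∀ c : PBond P k, Q k Y c = 0)
    (ΛB : (k : ℕ) → Site P k → Matrix n n ℂ) (hΛB0 : ∀ y, ΛB 0 y = 0)
    (hΛBs : ∀ (k : ℕ) (y : Site P (k + 1)), ΛB (k + 1) y = (P.L ^ k : ℕ) • combMean (bondAvgIter k B) y + ΛB k (emb y))
    (c : PBond P k) :
    (P.L ^ k : ℕ) • bondAvgIter k B c + (φ (embIter k c.tgt) - φ (embIter k c.src)) = ΛB k c.tgt - ΛB k c.src := by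
  -- a recursion family for the pure gauge `∂φ`, and the sum family for `Y`
  obtain ⟨Λφ, hΛφ0, hΛφs⟩ := exists_iterLambda (P := P) (fun b : PBond P 0 => φ b.tgt - φ b.src)
  obtain ⟨hS0, hSs⟩ := iterLambda_add B (fun b : PBond P 0 => φ b.tgt - φ b.src) ΛB Λφ hΛB0 hΛBs hΛφ0 hΛφs
  have hYfun : Y = fun b => B b + (φ b.tgt - φ b.src) := funext hY
  -- the identity for `Y`
  have hid := iterLin_eq_of_iterLambda Q hQ0 hQs Y (fun k y => ΛB k y + Λφ k y) hS0 (by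
    intro k' y; rw [hYfun]; exact hSs k' y) k hk c
  rw [hQY c] at hid
  -- `Λ_φ = Q′φ − φ∘embIter`, `L^k Q_k(∂φ) = ∂(Q′_kφ)`
  have hφ := iterLambda_grad φ Λφ hΛφ0 hΛφs k hk
  have hQφ : (P.L ^ k : ℕ) • bondAvgIter k (fun b : PBond P 0 => φ b.tgt - φ b.src) c = siteAvgIter k φ c.tgt - siteAvgIter k φ c.src := by
    have hg : (fun b : PBond P 0 => φ b.tgt - φ b.src) = grad 1 φ := by funext b; simp [grad]
    rw [hg, bondAvgIter_grad k hk 1 φ]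
    simp only [grad, one_div]
    rw [← Nat.cast_smul_eq_nsmul ℝ, smul_smul]
    have hL : ((P.L : ℝ) ^ k) ≠ 0 := pow_ne_zero _ (Nat.cast_ne_zero.mpr P.L_pos.ne')
    have hone : ((P.L ^ k : ℕ) : ℝ) * ((P.L : ℝ) ^ k)⁻¹ = 1 := by push_cast; exact mul_inv_cancel₀ hL
    rw [hone, one_smul]
  have hQsum : bondAvgIter k Y c = bondAvgIter k B c + bondAvgIter k (fun b : PBond P 0 => φ b.tgt - φ b.src) c := by
    rw [hYfun]
    have := congrFun (bondAvgIter_add (P := P) k B (fun b : PBond P 0 => φ b.tgt - φ b.src)) c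
    exact this
  rw [hQsum, smul_add, hQφ, hφ c.tgt, hφ c.src] at hid
  -- `hid : 0 = L^k Q_kB c + (Q′φ tgt − Q′φ src) − ((ΛB tgt + (Q′φ tgt − φ(emb tgt))) − (ΛB src + (Q′φ src − φ(emb src))))`
  have := hid
  rw [eq_comm, sub_eq_zero] at this
  -- rearrange
  have key : (P.L ^ k : ℕ) • bondAvgIter k B c + (siteAvgIter k φ c.tgt - siteAvgIter k φ c.src)
      = ΛB k c.tgt + (siteAvgIter k φ c.tgt - φ (embIter k c.tgt)) - (ΛB k c.src + (siteAvgIter k φ c.src - φ (embIter k c.src))) := this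
  have key2 := sub_eq_zero.mpr key
  rw [← sub_eq_zero]
  rw [← key2]
  abel

/-- **WITH THE `(H¹)^*`-BOUND (d = 3, `M_N(ℂ)` values)**: under the hypotheses of `constraint_on_hodge_parts` there is a recursion family `Λ_B` for `B` with the
identity AND `‖Λ_B(y)‖² ≤ ((d+2)L)²·N·L²·(L^k/(√L−1)²)·E_k(B)(y)` at every `k`-block, `E_k(B)(y)` the interior gradient energy of `B` on the fine block
(`Prop7IterLambdaBound.norm_sq_iterLambda_le`). [cite: Balaban1984PropagatorsI, (1.18)-(1.20) pp.19-20] -/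
theorem exists_constraint_on_hodge_parts_bound {N : ℕ} [NeZero N] (hd : P.d = 3)
    (Q : (i : ℕ) → (PBond P 0 → Matrix (Fin N) (Fin N) ℂ) → PBond P i → Matrix (Fin N) (Fin N) ℂ)
    (hQ0 : ∀ Y, Q 0 Y = Y) (hQs : ∀ (i : ℕ) (Y : PBond P 0 → Matrix (Fin N) (Fin N) ℂ) (c : PBond P (i + 1)), Q (i + 1) Y c = linAvg (Q i Y) c)
    (Y B : PBond P 0 → Matrix (Fin N) (Fin N) ℂ) (φ : Site P 0 → Matrix (Fin N) (Fin N) ℂ) (hY : ∀ b, Y b = B b + (φ b.tgt - φ b.src))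
    {k : ℕ} (hk : k ≤ P.m + P.K) (hQY : ∀ c : PBond P k, Q k Y c = 0) :
    ∃ ΛB : Site P k → Matrix (Fin N) (Fin N) ℂ,
      (∀ c : PBond P k, (P.L ^ k : ℕ) • bondAvgIter k B c + (φ (embIter k c.tgt) - φ (embIter k c.src)) = ΛB c.tgt - ΛB c.src) ∧
      ∀ y : Site P k, ‖ΛB y‖ ^ 2 ≤ ((((P.d + 2) * P.L : ℕ) : ℝ) ^ 2 * N * (P.L : ℝ) ^ 2 * ((P.L : ℝ) ^ k / (Real.sqrt P.L - 1) ^ 2)) *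
        ∑ μ : Fin P.d, ∑ ν : Fin P.d, ∑ x ∈ univ.filter (fun x : Site P 0 => Site.proj k k x = y),
          (if Site.proj k k (x.shift ν) = y then ‖B ⟨x.shift ν, μ⟩ - B ⟨x, μ⟩‖ ^ 2 else 0) := by
  obtain ⟨ΛB, h0, hs⟩ := exists_iterLambda (P := P) B
  exact ⟨ΛB k, fun c => constraint_on_hodge_parts Q hQ0 hQs Y B φ hY hk hQY ΛB h0 hs c,
    fun y => norm_sq_iterLambda_le hd B ΛB h0 hs hk y⟩

end Summit.QuantumFields.YangMills.Theorems.Prop7PinnedConstraintSplit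

end
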